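import Literature.AlgebraicGeometry.Motives.FamiliesVHSMorphism
import HarnessLib

/-!
# Constant variations: the VHS datum of a polarized `ℤ`-Hodge structure on the constant local systems `M_S`, `V_S`; the Tate data `ℤ_S(j)` and
# the unit `ℤ_S`; Hodge loci of constant data; global flat Hodge sections of `D` = morphisms `ℤ_S(−p) → D`

Topic `Literature/AlgebraicGeometry/Motives` (namespaces `Literature.AlgebraicGeometry.Motives.LocalSystem`, `….Motives.HodgeStructure`,
`….Motives.VHSData`), lane `lit-hodgefound` (seat `p08`, row g57-#1).  DEFINITIONS WITH BODIES (`VHSData.constRatIso`, `VHSData.const`,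
`VHSData.tate`, `VHSData.unit`, `VHSData.Hom.ofSection`, `VHSData.Hom.section`) and their API; no named fact, no instance, no notation (D-0026 net
debt `0`).  Sequel of `Motives/FamiliesVHSMorphism` (morphisms `VHSData.Hom`), `Motives/FamiliesVHSHom` (`cast`, `homRat`, `homClass`).

PRINTED SOURCES.  P. Deligne, *Équations différentielles à points singuliers réguliers*, LNM 163 (1970), I.1: the local systems on `S` form a
`⊗`-category with unit object the CONSTANT local system; a constant (trivial) local system is the functor `Π₁(S) → Mod` constant at a module, and
global sections of `V` are morphisms from the unit, `Γ(S, V) = Hom(1_S, V)`.  J. Carlson, S. Müller-Stach, C. Peters, *Period Mappings and Period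
Domains* (2nd ed., 2017), Examples 1.2.6 ((i) the trivial Hodge structure `ℤ`, (ii) the Tate twist `ℤ(k)`: weight `−2k`, type `(−k,−k)`), Cor. 13.1.12
and §15.3 («the largest constant local subsystem … is a constant variation of Hodge structure»), proof of Cor. 13.1.11 (a flat section of
`Hom(H, H')` of type `(0,0)`).  P. Deligne, *Théorie de Hodge II*, 2.1.13–2.1.14 (Tate structures `ℤ(n)`), 4.1.1 (global sections of `Rⁱf_*ℤ` as flat
sections; theorem of the fixed part).  W. Schmid, *Variation of Hodge structure*, Invent. Math. 22 (1973), §2 (polarized variations; `V_ℚ = V_ℤ ⊗ ℚ`).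
E. Cattani, P. Deligne, A. Kaplan, *On the locus of Hodge classes*, J. AMS 8 (1995), §1 (Hodge loci of a polarized `ℤ`VHS).

* §1 constant local systems: `const_map` (every map is `𝟙`), `const_mem_flatSections` (constant families are flat), `flatSections_const_apply_eq`,
  `mem_flatSections_const_iff` (over a path-connected base the flat sections of `M_S` are the constant families).
* §2 **`VHSData.const S hι Q : VHSData S n`** — the CONSTANT VARIATION attached to a polarized `ℤ`-Hodge structure: a finitely generated free
  abelian group `M`, a `ℚ`-vector space `V` with a `ℤ`-linear `ι : M → V` exhibiting `V = M ⊗ ℚ` (Mathlib `IsBaseChange ℚ ι`), a Hodge structure `H`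
  of weight `n` on `V` and a polarization `Q`: local systems `M_S`, `V_S` (the tree's `LocalSystem.const`), comparison `V_S ≅ M_S ⊗ ℚ` from
  `IsBaseChange.equiv` (`constRatIso`), the same `H`, `Q` on every fibre (flat because every transport is the identity).  API: `const_toRat`
  (`toRat m = ι m`), `const_form_toRat`, **`isHodgeAt_const_iff`** (`m` is a Hodge class of level `p` at `s` iff `ι m ∈ Hdgᵖ(H)` — independent of
  `s`), `isHodgeAt_const_transport_iff`, **`mem_hodgeLocusOfNormLe_const_iff`**, **`hodgeLocusOfNormLe_const_eq_univ_or_eq_empty`** (the Hodge loci of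
  a constant variation are all of `S` or empty), **`setOf_exists_isHodgeAt_transport_const_of_mem`** ∕ `…_of_not_mem` (the determination locus of `m` from `s` is
  the path component of `s`, or empty).
* §3 **the Tate data `VHSData.tate S j : VHSData S (−2j)`** = `const` for `M = ℤ`, `V = ℚ`, `ι = (ℤ → ℚ)` (`IsBaseChange.linearMap ℤ ℚ`), the tree's
  Tate structure `HodgeStructure.tate j` polarized by `Polarization.tate j` (`Q(x, y) = xy`); **`VHSData.unit S : VHSData S 0`** = `ℤ_S(0)` transported
  to weight `0`.  API: `HodgeStructure.mem_hodgeClasses_tate_iff` (`q ∈ Hdgᵖ(ℚ(j)) ⟺ p ≤ −j ∨ q = 0`), `tate_toRat` (`toRat m = m`), `tate_form_form`,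
  **`isHodgeAt_tate_iff`** (`m ∈ ℤ = ℤ(j)_s` is Hodge of level `p` iff `p ≤ −j ∨ m = 0`), `isHodgeAt_tate_neg` (every `m ∈ ℤ(−p)_s` is Hodge of level
  `p`), `unit_toRat`, `isHodgeAt_unit_iff`.
* §4 **global flat Hodge sections as morphisms from `ℤ_S(−p)`** (`Γ(S, V) = Hom(1_S, V)`, Deligne 1970 I.1, read with Hodge conditions): for `D` of
  weight `n = 2p` (as `h : −2·(−p) = n`), a family `v s ∈ V_ℤ,s` which is FLAT (`v ∈ flatSections`) and HODGE of level `p` at every point defines the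
  morphism **`Hom.ofSection D p h v hv hH : Hom ((tate S (−p)).cast h) D`** with lattice maps `r ↦ r·v s` (`ofSection_app_apply`,
  `ofSection_app_one`); conversely a morphism `φ : ℤ_S(−p) → D` has the flat, everywhere-Hodge section **`Hom.section φ = (s ↦ φ_s 1)`**
  (`section_mem_flatSections`, `isHodgeAt_section`), and `section_ofSection`, `ofSection_section` make the two constructions inverse.

HONEST SCOPE: as for every `VHSData`, holomorphy ∕ transversality are not recorded (for a constant variation they hold trivially); the theorem of the
fixed part itself (CMSP Thm. 13.1.10: flat sections have flat Hodge components) is a statement about honest polarized variations over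
quasi-projective bases and is NOT asserted here — §4 only packages the sections that are already Hodge everywhere.

## References

* [Deligne1970] P. Deligne, *Équations différentielles à points singuliers réguliers*, LNM 163 (1970), I.1.
* [CarlsonMullerStachPeters2017] J. Carlson, S. Müller-Stach, C. Peters, *Period Mappings and Period Domains*, 2nd ed., CUP (2017), Examples 1.2.6,
  Cor. 13.1.11–13.1.12, §15.3.
* [DeligneHodgeII1971] P. Deligne, *Théorie de Hodge II*, Publ. Math. IHÉS 40 (1971), 2.1.13–2.1.14, 4.1.1.
* [Schmid1973] W. Schmid, *Variation of Hodge structure: the singularities of the period mapping*, Invent. Math. 22 (1973), §2.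
* [Griffiths1970] P. Griffiths, *Periods of integrals on algebraic manifolds III*, Publ. Math. IHÉS 38 (1970), §1.
* [CattaniDeligneKaplan1995] E. Cattani, P. Deligne, A. Kaplan, *On the locus of Hodge classes*, J. Amer. Math. Soc. 8 (1995), §1.
-/

noncomputable section

open CategoryTheory
open scoped TensorProduct

universe u

namespace Literature.AlgebraicGeometry.Motives

/-! ## §1 Constant local systems: maps and flat sections -/

namespace LocalSystem

variable {R : Type u} [Ring R] {S : Type u} [TopologicalSpace S]

/-- Every map of the constant local system `M_S` is the identity of `M` (Deligne 1970, I.1: the functor `Π₁(S) → Mod` constant at `M`).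
[cite: Deligne1970, I.1] -/
theorem const_map (M : ModuleCat.{u} R) {x y : FundamentalGroupoid S} (g : x ⟶ y) : (const R S M).map g = 𝟙 M := rfl

/-- Constant families are flat sections of the constant local system. [cite: Deligne1970, I.1] -/
theorem const_mem_flatSections (M : ModuleCat.{u} R) (m : M) : (fun _ : S => m) ∈ (const R S M).flatSections :=
  fun _ _ _ => rfl

/-- A flat section of a constant local system takes the same value at any two joined points. [cite: Deligne1970, I.1] -/
theorem flatSections_const_apply_eq (M : ModuleCat.{u} R) {v : ∀ s : S, (const R S M).fiber s} (hv : v ∈ (const R S M).flatSections)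
    {s t : S} (h : Joined s t) : v s = v t := by
  obtain ⟨γ⟩ := h
  exact hv s t ⟦γ⟧

/-- **Over a path-connected base the flat sections of `M_S` are exactly the constant families** (`Γ(S, M_S) = M`). [cite: Deligne1970, I.1] -/
theorem mem_flatSections_const_iff [PathConnectedSpace S] (M : ModuleCat.{u} R) (v : ∀ s : S, (const R S M).fiber s) :
    v ∈ (const R S M).flatSections ↔ ∃ m : M, v = fun _ => m := by
  constructor
  · intro hv
    obtain ⟨s₀⟩ := (inferInstance : PathConnectedSpace S).nonempty
    exact ⟨v s₀, funext fun t => (flatSections_const_apply_eq M hv (PathConnectedSpace.joined s₀ t)).symm⟩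
  · rintro ⟨m, rfl⟩
    exact const_mem_flatSections M m

end LocalSystem

/-! ## §2 The constant variation attached to a polarized `ℤ`-Hodge structure -/

namespace VHSData

variable (S : Type) [TopologicalSpace S]

section Const

variable {M : Type} [AddCommGroup M] [Module.Finite ℤ M] [Module.Free ℤ M] {V : Type} [AddCommGroup V] [Module ℚ V]
  {ι : M →ₗ[ℤ] V} (hι : IsBaseChange ℚ ι) {n : ℤ} {H : HodgeStructure V n} (Q : H.Polarization)

/-- **The comparison `V_S ≅ M_S ⊗ ℚ` of the constant local systems** attached to a lattice `ι : M → V` with `V = M ⊗ ℚ` (Mathlib `IsBaseChange`): at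
every point the inverse of `IsBaseChange.equiv : ℚ ⊗_ℤ M ⥲ V` (`1 ⊗ m ↦ ι m`); naturality is trivial since all maps of a constant local system are
identities. [cite: Schmid1973, §2 (`V_ℚ = V_ℤ ⊗ ℚ`)] [cite: Deligne1970, I.1] -/
def constRatIso : LocalSystem.const ℚ S (ModuleCat.of ℚ V) ≅ (LocalSystem.const ℤ S (ModuleCat.of ℤ M)).baseChange (Int.castRingHom ℚ) :=
  NatIso.ofComponents (fun _ => hι.equiv.symm.toModuleIso) fun {x y} g => by
    change 𝟙 (ModuleCat.of ℚ V) ≫ hι.equiv.symm.toModuleIso.hom =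
      hι.equiv.symm.toModuleIso.hom ≫ (ModuleCat.extendScalars (Int.castRingHom ℚ)).map (𝟙 (ModuleCat.of ℤ M))
    rw [CategoryTheory.Functor.map_id]
    exact (Category.id_comp _).trans (Category.comp_id _).symm

/-- **The constant variation of Hodge structure attached to a polarized `ℤ`-Hodge structure** `(M, V = M ⊗ ℚ, F, Q)` on `S` (Deligne 1970 I.1: the
constant local system; Carlson–Müller-Stach–Peters §15.3: «constant variation of Hodge structure»): integral local system `M_S`, rational local system
`V_S` (every transport the identity), comparison `V_S ≅ M_S ⊗ ℚ` (`constRatIso`), on every fibre the Hodge structure `H` of weight `n` polarized by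
`Q` — flat because the transports are identities; the integral fibres `M` are finitely generated free by hypothesis.
[cite: Deligne1970, I.1] [cite: CarlsonMullerStachPeters2017, §15.3 and Cor. 13.1.12] [cite: Schmid1973, §2] -/
def const : VHSData S n where
  VZ := LocalSystem.const ℤ S (ModuleCat.of ℤ M)
  V := LocalSystem.const ℚ S (ModuleCat.of ℚ V)
  ratIso := constRatIso S hι
  hodge _ := H
  form _ := Q
  transport_form _ _ _ _ _ := rfl
  finite_free _ := ⟨‹Module.Finite ℤ M›, ‹Module.Free ℤ M›⟩

variable {S}

/-- The integral local system of the constant variation is `M_S`. [cite: Deligne1970, I.1] -/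
@[simp] theorem const_VZ : (const S hι Q).VZ = LocalSystem.const ℤ S (ModuleCat.of ℤ M) := rfl

/-- The rational local system of the constant variation is `V_S`. [cite: Deligne1970, I.1] -/
@[simp] theorem const_V : (const S hι Q).V = LocalSystem.const ℚ S (ModuleCat.of ℚ V) := rfl

/-- The Hodge structure of the constant variation at every point is `H`. [cite: CarlsonMullerStachPeters2017, §15.3] -/
theorem const_hodge (s : S) : (const S hι Q).hodge s = H := rfl

/-- The polarization form of the constant variation at every point is `Q`. [cite: CarlsonMullerStachPeters2017, §15.3] -/
theorem const_form_form (s : S) : ((const S hι Q).form s).form = Q.form := rfl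

/-- Integral transport of the constant variation is the identity. [cite: Deligne1970, I.1] -/
theorem const_VZ_transport {s t : S} (γ : Path.Homotopic.Quotient s t) : (const S hι Q).VZ.transport γ = LinearMap.id := rfl

/-- Rational transport of the constant variation is the identity. [cite: Deligne1970, I.1] -/
theorem const_V_transport {s t : S} (γ : Path.Homotopic.Quotient s t) : (const S hι Q).V.transport γ = LinearMap.id := rfl

/-- **`toRat m = ι m`**: the comparison `M = V_ℤ,s → V_s = V` of the constant variation is the structure map `ι` (`IsBaseChange.equiv (1 ⊗ m) = ι m`).
[cite: Schmid1973, §2 (`V_ℚ = V_ℤ ⊗ ℚ`)] -/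
theorem const_toRat (s : S) (m : M) : (const S hι Q).toRat s m = ι m := by
  change hι.equiv ((1 : ℚ) ⊗ₜ[ℤ] m) = ι m
  rw [IsBaseChange.equiv_tmul, one_smul]

/-- The polarization of the constant variation on integral vectors: `Q_s(toRat m, toRat m') = Q(ι m, ι m')`. [cite: Schmid1973, §2] -/
theorem const_form_toRat (s : S) (m m' : M) :
    ((const S hι Q).form s).form ((const S hι Q).toRat s m) ((const S hι Q).toRat s m') = Q.form (ι m) (ι m') := by
  rw [const_toRat, const_toRat]
  rfl

/-- **Hodge classes of a constant variation**: `m ∈ M = V_ℤ,s` is a Hodge class of level `p` at `s` iff `ι m ∈ Hdgᵖ(H)` — a condition independent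
of the point `s`. [cite: CattaniDeligneKaplan1995, §1] [cite: CarlsonMullerStachPeters2017, §15.3] -/
theorem isHodgeAt_const_iff (s : S) (p : ℤ) (m : M) : (const S hι Q).IsHodgeAt s p m ↔ ι m ∈ H.hodgeClasses p := by
  change (const S hι Q).toRat s m ∈ H.hodgeClasses p ↔ _
  rw [const_toRat]
  exact Iff.rfl

/-- Determinations in a constant variation: `γ_* m = m` is Hodge of level `p` at `t` iff `m` is Hodge of level `p` at `s`. [cite: CattaniDeligneKaplan1995, §1] -/
theorem isHodgeAt_const_transport_iff {s t : S} (γ : Path.Homotopic.Quotient s t) (p : ℤ) (m : M) :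
    (const S hι Q).IsHodgeAt t p ((const S hι Q).VZ.transport γ m) ↔ (const S hι Q).IsHodgeAt s p m := by
  rw [isHodgeAt_const_iff, isHodgeAt_const_iff]
  exact Iff.rfl

/-- **The Hodge locus of a constant variation, unfolded**: `s` lies in the Hodge locus of level `p` and self-intersection `≤ K` iff SOME nonzero `m ∈ M`
has `ι m ∈ Hdgᵖ(H)` and `Q(ι m, ι m) ≤ K` — a condition independent of `s`. [cite: CattaniDeligneKaplan1995, §1, Thm. 1.1] -/
theorem mem_hodgeLocusOfNormLe_const_iff (p K : ℤ) (s : S) :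
    s ∈ (const S hι Q).hodgeLocusOfNormLe p K ↔ ∃ m : M, m ≠ 0 ∧ ι m ∈ H.hodgeClasses p ∧ Q.form (ι m) (ι m) ≤ (K : ℚ) := by
  change (∃ m : M, m ≠ 0 ∧ (const S hι Q).IsHodgeAt s p m ∧
    ((const S hι Q).form s).form ((const S hι Q).toRat s m) ((const S hι Q).toRat s m) ≤ (K : ℚ)) ↔ _
  simp only [isHodgeAt_const_iff, const_form_toRat]

/-- **The Hodge loci of a constant variation are all of `S` or empty.** [cite: CattaniDeligneKaplan1995, §1, Thm. 1.1] [cite: CarlsonMullerStachPeters2017, §15.3] -/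
theorem hodgeLocusOfNormLe_const_eq_univ_or_eq_empty (p K : ℤ) :
    (const S hι Q).hodgeLocusOfNormLe p K = Set.univ ∨ (const S hι Q).hodgeLocusOfNormLe p K = ∅ := by
  by_cases h : ∃ m : M, m ≠ 0 ∧ ι m ∈ H.hodgeClasses p ∧ Q.form (ι m) (ι m) ≤ (K : ℚ)
  · exact Or.inl (Set.eq_univ_of_forall fun s => (mem_hodgeLocusOfNormLe_const_iff hι Q p K s).2 h)
  · exact Or.inr (Set.ext fun s => ⟨fun hs => h ((mem_hodgeLocusOfNormLe_const_iff hι Q p K s).1 hs), fun hs => hs.elim⟩)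

/-- **The determination locus of a Hodge vector of a constant variation is its whole path component**: if `ι m ∈ Hdgᵖ(H)`, the set of `t` joined to
`s` by a path class `γ` with `γ_* m` Hodge of level `p` at `t` is the path component of `s`. [cite: CattaniDeligneKaplan1995, §1, Cor. 1.3] -/
theorem setOf_exists_isHodgeAt_transport_const_of_mem (s : S) (p : ℤ) {m : M} (hm : ι m ∈ H.hodgeClasses p) :
    {t : S | ∃ γ : Path.Homotopic.Quotient s t, (const S hι Q).IsHodgeAt t p ((const S hι Q).VZ.transport γ m)} = pathComponent s := by
  ext t
  rw [Set.mem_setOf_eq, mem_pathComponent_iff]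
  constructor
  · rintro ⟨γ, -⟩
    induction γ using Quotient.inductionOn with
    | h γ => exact ⟨γ⟩
  · rintro ⟨γ⟩
    exact ⟨⟦γ⟧, (isHodgeAt_const_transport_iff hι Q _ p m).2 ((isHodgeAt_const_iff hι Q s p m).2 hm)⟩

/-- … and **empty otherwise**: if `ι m ∉ Hdgᵖ(H)`, no determination of `m` is a Hodge class of level `p`. [cite: CattaniDeligneKaplan1995, §1, Cor. 1.3] -/
theorem setOf_exists_isHodgeAt_transport_const_of_not_mem (s : S) (p : ℤ) {m : M} (hm : ι m ∉ H.hodgeClasses p) :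
    {t : S | ∃ γ : Path.Homotopic.Quotient s t, (const S hι Q).IsHodgeAt t p ((const S hι Q).VZ.transport γ m)} = ∅ :=
  Set.ext fun _ => ⟨fun ⟨γ, ht⟩ => hm ((isHodgeAt_const_iff hι Q s p m).1 ((isHodgeAt_const_transport_iff hι Q γ p m).1 ht)),
    fun ht => ht.elim⟩

end Const

end VHSData

/-! ## §3 The Tate data `ℤ_S(j)` and the unit `ℤ_S` -/

namespace HodgeStructure

/-- **The Hodge classes of the Tate structure `ℚ(j)`**: `q ∈ Hdgᵖ(ℚ(j))` iff `p ≤ −j` or `q = 0` (`F^p ℚ(j)_ℂ` is everything for `p ≤ −j` and zero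
beyond; `ℚ(j)` is of type `(−j, −j)`). [cite: CarlsonMullerStachPeters2017, Examples 1.2.6 (ii)] [cite: DeligneHodgeII1971, 2.1.13] -/
theorem mem_hodgeClasses_tate_iff (j p : ℤ) (q : ℚ) : q ∈ (tate j).hodgeClasses p ↔ p ≤ -j ∨ q = 0 := by
  rw [mem_hodgeClasses_iff, tate_F]
  by_cases h : p ≤ -j
  · rw [pureFiltration_of_le h]
    simp only [Submodule.mem_top, h, true_or]
  · rw [pureFiltration_of_lt (not_le.1 h), Submodule.mem_bot]
    simp only [h, false_or]
    constructor
    · intro h0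
      have h1 := congrArg (TensorProduct.rid ℚ ℂ) h0
      rw [ofRat_apply, TensorProduct.rid_tmul, map_zero, smul_eq_zero] at h1
      exact h1.resolve_right one_ne_zero
    · rintro rfl
      rw [map_zero]

end HodgeStructure

namespace VHSData

variable (S : Type) [TopologicalSpace S]

/-- **The Tate variation `ℤ_S(j)`** of weight `−2j` on `S`: the constant variation attached to the lattice `ℤ ⊂ ℚ` (`IsBaseChange.linearMap ℤ ℚ`) with
the Tate structure `ℚ(j)` of the tree (`HodgeStructure.tate j`, type `(−j, −j)`) polarized by `Q(x, y) = xy` (`Polarization.tate j`).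
[cite: CarlsonMullerStachPeters2017, Examples 1.2.6 (ii)] [cite: DeligneHodgeII1971, 2.1.13–2.1.14] [cite: Deligne1970, I.1] -/
def tate (j : ℤ) : VHSData S (-2 * j) :=
  const S (IsBaseChange.linearMap ℤ ℚ) (HodgeStructure.Polarization.tate j)

/-- **The unit variation `ℤ_S = ℤ_S(0)`** of weight `0` (the unit object of the `⊗`-category of local systems with its trivial Hodge structure of type
`(0,0)`), as `ℤ_S(0)` transported to weight `0`. [cite: Deligne1970, I.1] [cite: CarlsonMullerStachPeters2017, Examples 1.2.6 (i)] -/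
def unit : VHSData S 0 :=
  (tate S 0).cast (mul_zero (-2))

variable {S}

/-- The integral local system of `ℤ_S(j)` is the constant local system `ℤ_S`. [cite: Deligne1970, I.1] -/
theorem tate_VZ (j : ℤ) : (tate S j).VZ = LocalSystem.const ℤ S (ModuleCat.of ℤ ℤ) := rfl

/-- The rational local system of `ℤ_S(j)` is the constant local system `ℚ_S`. [cite: Deligne1970, I.1] -/
theorem tate_V (j : ℤ) : (tate S j).V = LocalSystem.const ℚ S (ModuleCat.of ℚ ℚ) := rfl

/-- The Hodge structure of `ℤ_S(j)` at every point is the Tate structure `ℚ(j)`. [cite: CarlsonMullerStachPeters2017, Examples 1.2.6 (ii)] -/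
theorem tate_hodge (j : ℤ) (s : S) : (tate S j).hodge s = HodgeStructure.tate j := rfl

/-- The Hodge filtration of `ℤ_S(j)` at every point: `F^p = ` everything for `p ≤ −j`, zero beyond (`pureFiltration ℚ (−j)`).
[cite: CarlsonMullerStachPeters2017, Examples 1.2.6 (ii)] -/
theorem tate_hodge_F (j : ℤ) (s : S) (p : ℤ) : ((tate S j).hodge s).F p = HodgeStructure.pureFiltration ℚ (-j) p := rfl

/-- **`toRat m = m`** for `ℤ_S(j)`: the comparison `ℤ → ℚ` is the inclusion. [cite: Schmid1973, §2] -/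
theorem tate_toRat (j : ℤ) (s : S) (m : ℤ) : (tate S j).toRat s m = (m : ℚ) := by
  change (const S (IsBaseChange.linearMap ℤ ℚ) (HodgeStructure.Polarization.tate j)).toRat s m = _
  rw [const_toRat]
  exact eq_intCast (algebraMap ℤ ℚ) m

/-- The polarization of `ℤ_S(j)` is multiplication: `Q(x, y) = xy`. [cite: DeligneHodgeII1971, 2.1.14–2.1.15] -/
theorem tate_form_form (j : ℤ) (s : S) (x y : ℚ) : ((tate S j).form s).form x y = x * y := rfl

/-- **Hodge classes of `ℤ_S(j)`**: `m ∈ ℤ = ℤ(j)_s` is a Hodge class of level `p` at `s` iff `p ≤ −j` or `m = 0`. [cite: CarlsonMullerStachPeters2017, Examples 1.2.6 (ii)]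
[cite: CattaniDeligneKaplan1995, §1] -/
theorem isHodgeAt_tate_iff (j : ℤ) (s : S) (p : ℤ) (m : ℤ) : (tate S j).IsHodgeAt s p m ↔ p ≤ -j ∨ m = 0 := by
  change (const S (IsBaseChange.linearMap ℤ ℚ) (HodgeStructure.Polarization.tate j)).IsHodgeAt s p m ↔ _
  rw [isHodgeAt_const_iff, Algebra.linearMap_apply, HodgeStructure.mem_hodgeClasses_tate_iff, eq_intCast, Int.cast_eq_zero]

/-- Every integral vector of `ℤ_S(−p)` is a Hodge class of level `p` (`ℤ(−p)` is of type `(p, p)`). [cite: CarlsonMullerStachPeters2017, Examples 1.2.6 (ii)] -/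
theorem isHodgeAt_tate_neg (p : ℤ) (s : S) (m : ℤ) : (tate S (-p)).IsHodgeAt s p m :=
  (isHodgeAt_tate_iff (-p) s p m).2 (Or.inl (neg_neg p).ge)

/-- The integral local system of `ℤ_S` is the constant local system `ℤ_S`. [cite: Deligne1970, I.1] -/
theorem unit_VZ : (unit S).VZ = LocalSystem.const ℤ S (ModuleCat.of ℤ ℤ) := rfl

/-- `toRat m = m` for the unit variation. [cite: Schmid1973, §2] -/
theorem unit_toRat (s : S) (m : ℤ) : (unit S).toRat s m = (m : ℚ) :=
  tate_toRat 0 s m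

/-- Hodge classes of the unit variation: `m` is Hodge of level `p` iff `p ≤ 0` or `m = 0` (`ℤ` is of type `(0,0)`). [cite: CarlsonMullerStachPeters2017, Examples 1.2.6 (i)] -/
theorem isHodgeAt_unit_iff (s : S) (p : ℤ) (m : ℤ) : (unit S).IsHodgeAt s p m ↔ p ≤ 0 ∨ m = 0 := by
  change ((tate S 0).cast (mul_zero (-2))).IsHodgeAt s p m ↔ _
  rw [isHodgeAt_cast_iff, isHodgeAt_tate_iff, neg_zero]

/-- Every integral vector of the unit variation is a Hodge class of level `0`. [cite: CarlsonMullerStachPeters2017, Examples 1.2.6 (i)] -/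
theorem isHodgeAt_unit_zero (s : S) (m : ℤ) : (unit S).IsHodgeAt s 0 m :=
  (isHodgeAt_unit_iff s 0 m).2 (Or.inl le_rfl)

/-! ## §4 Global flat Hodge sections of `D` are the morphisms `ℤ_S(−p) → D` -/

section Sections

variable {n : ℤ} (D : VHSData S n)

/-- For `x ∈ W` with `1 ⊗ x ∈ F` (`F ⊆ W_ℂ` a complex subspace), the complexification of `q ↦ q · x : ℚ → W` takes values in `F`
(on `c ⊗ q` it gives `(qc) · (1 ⊗ x)`). [folklore] -/
private theorem baseChange_toSpanSingleton_apply_mem {W : Type} [AddCommGroup W] [Module ℚ W] (F : Submodule ℂ (ℂ ⊗[ℚ] W)) (x : W)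
    (hx : HodgeStructure.ofRat x ∈ F) (z : ℂ ⊗[ℚ] ℚ) : (LinearMap.toSpanSingleton ℚ W x).baseChange ℂ z ∈ F := by
  induction z using TensorProduct.induction_on with
  | zero =>
    rw [map_zero]
    exact Submodule.zero_mem _
  | tmul c q =>
    rw [LinearMap.baseChange_tmul, LinearMap.toSpanSingleton_apply, TensorProduct.tmul_smul,
      show c ⊗ₜ[ℚ] x = c • HodgeStructure.ofRat x by rw [HodgeStructure.ofRat_apply, TensorProduct.smul_tmul', smul_eq_mul, mul_one]]
    exact Submodule.smul_of_tower_mem F q (Submodule.smul_mem F c hx)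
  | add x y hx hy =>
    rw [map_add]
    exact Submodule.add_mem _ hx hy

/-- The rationalization of the lattice map `ℤ → V_ℤ,s`, `r ↦ r · v`, out of `ℤ(−p)_s = ℤ` is `q ↦ q · toRat v`. [cite: Schmid1973, §2] -/
theorem homRat_toSpanSingleton (p : ℤ) (h : -2 * -p = n) (s : S) (v : D.VZ.fiber s) :
    ((tate S (-p)).cast h).homRat D s (LinearMap.toSpanSingleton ℤ (D.VZ.fiber s) v) =
      LinearMap.toSpanSingleton ℚ (D.V.fiber s) (D.toRat s v) := by
  -- on `r ∈ ℤ = ℤ(−p)_s`: `r · toRat v = toRat (r · v)`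
  have key : ∀ r : ℤ, LinearMap.toSpanSingleton ℚ (D.V.fiber s) (D.toRat s v) (((tate S (-p)).cast h).toRat s r) =
      D.toRat s (LinearMap.toSpanSingleton ℤ (D.VZ.fiber s) v r) := fun r => by
    change LinearMap.toSpanSingleton ℚ (D.V.fiber s) (D.toRat s v) ((tate S (-p)).toRat s r) =
      D.toRatLinear ⟨s⟩ (LinearMap.toSpanSingleton ℤ (D.VZ.fiber s) v r)
    rw [tate_toRat, LinearMap.toSpanSingleton_apply, LinearMap.toSpanSingleton_apply, (D.toRatLinear ⟨s⟩).map_smul,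
      ← Int.cast_smul_eq_zsmul ℚ, toRatLinear_apply]
  exact (((tate S (-p)).cast h).homRat_unique D s _ _ fun m => key m).symm

/-- **A global flat section of `V_ℤ` which is a Hodge class of level `p` at every point is a morphism `ℤ_S(−p) → D`** (`Γ(S, V) = Hom(1_S, V)`,
Deligne 1970 I.1, read with the Hodge conditions; `D` of weight `n = 2p`, recorded as `h : −2·(−p) = n`): lattice maps `r ↦ r · v s`, flat because
`v` is flat, Hodge because `q ↦ q · toRat (v s)` maps `F^{p'} ℚ(−p) = ℚ(−p)_ℂ` (`p' ≤ p`) into `ℂ · (1 ⊗ toRat (v s)) ⊆ F^p ⊆ F^{p'}`.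
[cite: Deligne1970, I.1] [cite: DeligneHodgeII1971, 4.1.1] [cite: CarlsonMullerStachPeters2017, proof of Cor. 13.1.11] -/
def Hom.ofSection (p : ℤ) (h : -2 * -p = n) (v : ∀ s : S, D.VZ.fiber s) (hv : v ∈ D.VZ.flatSections)
    (hH : ∀ s : S, D.IsHodgeAt s p (v s)) : Hom ((tate S (-p)).cast h) D :=
  Hom.ofFlat (fun s => LinearMap.toSpanSingleton ℤ (D.VZ.fiber s) (v s))
    (fun {s t} γ r => by
      change LinearMap.toSpanSingleton ℤ (D.VZ.fiber t) (v t) (r : ℤ) = D.VZ.transport γ (LinearMap.toSpanSingleton ℤ (D.VZ.fiber s) (v s) r)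
      rw [LinearMap.toSpanSingleton_apply, LinearMap.toSpanSingleton_apply, (D.VZ.transport γ).map_smul, hv s t γ])
    (fun s p' => by
      rw [homRat_toSpanSingleton]
      by_cases hp : p' ≤ p
      · rw [Submodule.map_le_iff_le_comap]
        rintro z -
        rw [Submodule.mem_comap]
        exact baseChange_toSpanSingleton_apply_mem ((D.hodge s).F p') (D.toRat s (v s))
          ((D.hodge s).antitone_F hp ((HodgeStructure.mem_hodgeClasses_iff _ _ _).1 (hH s))) z
      · have hF : (((tate S (-p)).cast h).hodge s).F p' = ⊥ := HodgeStructure.pureFiltration_of_lt (by omega)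
        rw [hF, Submodule.map_bot]
        exact bot_le)

/-- The lattice maps of `Hom.ofSection`: `r ↦ r · v s`. [cite: Deligne1970, I.1] -/
@[simp] theorem Hom.ofSection_app (p : ℤ) (h : -2 * -p = n) (v : ∀ s : S, D.VZ.fiber s) (hv : v ∈ D.VZ.flatSections)
    (hH : ∀ s : S, D.IsHodgeAt s p (v s)) (s : S) :
    (Hom.ofSection D p h v hv hH).app s = LinearMap.toSpanSingleton ℤ (D.VZ.fiber s) (v s) := rfl

/-- `Hom.ofSection` sends `1 ∈ ℤ(−p)_s` to `v s`. [cite: Deligne1970, I.1] -/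
theorem Hom.ofSection_app_one (p : ℤ) (h : -2 * -p = n) (v : ∀ s : S, D.VZ.fiber s) (hv : v ∈ D.VZ.flatSections)
    (hH : ∀ s : S, D.IsHodgeAt s p (v s)) (s : S) : (Hom.ofSection D p h v hv hH).app s (1 : ℤ) = v s :=
  LinearMap.toSpanSingleton_apply_one ℤ (D.VZ.fiber s) (v s)

/-- **The global section `s ↦ φ_s(1)` of a morphism `φ : ℤ_S(−p) → D`.** [cite: Deligne1970, I.1] -/
def Hom.section {p : ℤ} {h : -2 * -p = n} (φ : Hom ((tate S (-p)).cast h) D) (s : S) : D.VZ.fiber s :=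
  φ.app s (1 : ℤ)

/-- `Hom.section` unfolded. [cite: Deligne1970, I.1] -/
theorem Hom.section_apply {p : ℤ} {h : -2 * -p = n} (φ : Hom ((tate S (-p)).cast h) D) (s : S) : φ.section D s = φ.app s (1 : ℤ) := rfl

/-- **The section of a morphism `ℤ_S(−p) → D` is flat** (`φ_t(γ_* 1) = γ_*(φ_s 1)` and `γ_* 1 = 1` in the constant local system).
[cite: Deligne1970, I.1] [cite: DeligneHodgeII1971, 4.1.1] -/
theorem Hom.section_mem_flatSections {p : ℤ} {h : -2 * -p = n} (φ : Hom ((tate S (-p)).cast h) D) : φ.section D ∈ D.VZ.flatSections :=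
  fun _ _ γ => (φ.app_transport γ (1 : ℤ)).symm

/-- **The section of a morphism `ℤ_S(−p) → D` is a Hodge class of level `p` at every point** (`1 ∈ ℤ(−p)` is of type `(p, p)` and morphisms
preserve Hodge classes). [cite: DeligneHodgeII1971, 4.1.1] [cite: CattaniDeligneKaplan1995, §1] -/
theorem Hom.isHodgeAt_section {p : ℤ} {h : -2 * -p = n} (φ : Hom ((tate S (-p)).cast h) D) (s : S) : D.IsHodgeAt s p (φ.section D s) :=
  φ.isHodgeAt_app ((((tate S (-p)).isHodgeAt_cast_iff h s p (1 : ℤ))).2 (isHodgeAt_tate_neg p s 1))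

/-- The section of `Hom.ofSection v` is `v`. [cite: Deligne1970, I.1] -/
theorem Hom.section_ofSection (p : ℤ) (h : -2 * -p = n) (v : ∀ s : S, D.VZ.fiber s) (hv : v ∈ D.VZ.flatSections)
    (hH : ∀ s : S, D.IsHodgeAt s p (v s)) : (Hom.ofSection D p h v hv hH).section D = v :=
  funext fun s => Hom.ofSection_app_one D p h v hv hH s

/-- The morphism of the section of `φ` is `φ` (a `ℤ`-linear map out of `ℤ` is determined by its value at `1`). [cite: Deligne1970, I.1] -/
theorem Hom.ofSection_section {p : ℤ} {h : -2 * -p = n} (φ : Hom ((tate S (-p)).cast h) D) :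
    Hom.ofSection D p h (φ.section D) (φ.section_mem_flatSections D) (φ.isHodgeAt_section D) = φ :=
  Hom.ext_of_app _ _ fun s => LinearMap.ext_ring (Hom.ofSection_app_one D p h _ _ _ s)

end Sections

end VHSData

end Literature.AlgebraicGeometry.Motives

end
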